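import Mathlib
import Summits.ValiantsHypothesis.ValiantsHypothesis.Theorems.RigidityForcesSymmetryRankRigidMinimalReprLaplaceFourDefs
import Summits.ValiantsHypothesis.ValiantsHypothesis.Theorems.RigidityForcesSymmetryRankRigidMinimalReprLaplaceFourContraction
import Summits.ValiantsHypothesis.ValiantsHypothesis.Theorems.RigidityForcesSymmetryRankRigidMinimalReprLaplaceFourLineCore
import Summits.ValiantsHypothesis.ValiantsHypothesis.Theorems.RigidityForcesSymmetryRankRigidMinimalReprLaplaceFourLineKills

/-!
# LINE profiles of `LaplaceOptimal 4`: the normal form along a matching (Lemma A)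
# (crux `RankRigidMinimalRepr`, stmt-ValiantsHypothesis-18034, route `RigidityForcesSymmetry`)

For the two remaining LINE profiles `(3,1,1)` and `slice+(2,1,1)` the rank-one terms are a pair term on `02|13`
(`b(v₀,v₂) b′(v₁,v₃)`: contracted column `Bψ`, row `B′φ`) and a pair term on `03|12` (`c(v₀,v₃) c′(v₁,v₂)`: column `C′φ`,
row `Cψ`).  Along the star the columns are affine in `φ` and `star_kill` applies.  Along the matching `ψ = (φ₀,-φ₁,0,0)`
the identity `Q(ψ,φ) = (Bψ)(B′φ)ᵀ + (C′φ)(Cψ)ᵀ` on the torus does NOT give a contradiction by itself but forces the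
NORMAL FORM of Lemma A (`matching_shape`): the arrays `b, b′, c, c′` vanish outside the patterns
`b₀₁ = b₁₀ = λ`, `b′₀₁ = -b′₁₀`, `b′₂₃ = b′₃₂ = σ′`, `c′₀₁ = -c′₁₀`, `c′₂₃ = c′₃₂ = τ′`, `c₀₁ = c₁₀ = λ′` on the rows /
columns `0, 1` that the matching sees, with `λσ′ = λ′τ′ = 1` and `λ b′₁₀ + λ′ c′₁₀ = 0`.  Tools: the annihilators
`(0,0,φ₂,-φ₃)` and `(φ₀,φ₁,0,0)` of `uwᵀ + wuᵀ` (`two_rank_one_cols`), applied to columns and — by symmetry of `Q` — to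
rows, the extraction lemmas `quad_identity_23` and `quad_identity_01`, and evaluation at `φ = 𝟙`.

HONEST FRAMING: finite algebra toward `LaplaceOptimal 4` (rung `TiedTorusBound 3`); the crux stays OPEN; nothing here
bears on `VP ≠ VNP`.
-/

set_option autoImplicit false

-- the mandated summit-side namespace repeats a component by design (single-problem summit)
set_option linter.dupNamespace false

namespace Summit.ValiantsHypothesis.ValiantsHypothesis.Theorems.RigidityForcesSymmetryRankRigidMinimalRepr

namespace LaplaceFourLine

open Matrix LaplaceFourContraction

/-! ### §1 One more extraction lemma -/

/-- Coefficient extraction: if `φ_0·L_0(φ) + φ_1·L_1(φ) = 0` on the torus for affine forms `L_k(φ) = c_k + Σ_x a_xk φ_x`,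
then the listed coefficients vanish. -/
theorem quad_identity_01 (c : Fin 4 → ℂ) (a : Fin 4 → Fin 4 → ℂ)
    (h : ∀ φ : Fin 4 → ℂ, (∀ i, φ i ≠ 0) →
      φ 0 * (c 0 + ∑ x, a x 0 * φ x) + φ 1 * (c 1 + ∑ x, a x 1 * φ x) = 0) :
    c 0 = 0 ∧ c 1 = 0 ∧ a 0 0 = 0 ∧ a 1 0 + a 0 1 = 0 ∧ a 2 0 = 0 ∧ a 3 0 = 0 ∧ a 1 1 = 0 ∧ a 2 1 = 0 ∧ a 3 1 = 0 := by
  have e1111 := h ![(1 : ℂ), (1 : ℂ), (1 : ℂ), (1 : ℂ)] (by intro i; fin_cases i <;> norm_num)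
  have e1112 := h ![(1 : ℂ), (1 : ℂ), (1 : ℂ), (2 : ℂ)] (by intro i; fin_cases i <;> norm_num)
  have e1121 := h ![(1 : ℂ), (1 : ℂ), (2 : ℂ), (1 : ℂ)] (by intro i; fin_cases i <;> norm_num)
  have e1211 := h ![(1 : ℂ), (2 : ℂ), (1 : ℂ), (1 : ℂ)] (by intro i; fin_cases i <;> norm_num)
  have e1212 := h ![(1 : ℂ), (2 : ℂ), (1 : ℂ), (2 : ℂ)] (by intro i; fin_cases i <;> norm_num)
  have e1221 := h ![(1 : ℂ), (2 : ℂ), (2 : ℂ), (1 : ℂ)] (by intro i; fin_cases i <;> norm_num)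
  have e1311 := h ![(1 : ℂ), (3 : ℂ), (1 : ℂ), (1 : ℂ)] (by intro i; fin_cases i <;> norm_num)
  have e2111 := h ![(2 : ℂ), (1 : ℂ), (1 : ℂ), (1 : ℂ)] (by intro i; fin_cases i <;> norm_num)
  have e2211 := h ![(2 : ℂ), (2 : ℂ), (1 : ℂ), (1 : ℂ)] (by intro i; fin_cases i <;> norm_num)
  simp only [Fin.sum_univ_four, Matrix.cons_val_zero, Matrix.cons_val_one, Matrix.head_cons, Matrix.cons_val_two,
    Matrix.tail_cons, Matrix.cons_val_three] at e1111 e1112 e1121 e1211 e1212 e1221 e1311 e2111 e2211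
  refine ⟨?_, ?_, ?_, ?_, ?_, ?_, ?_, ?_, ?_⟩
  · linear_combination ((19 : ℂ)/2) * e1111 + (-2 : ℂ) * e1112 + (-2 : ℂ) * e1121 +
      (-7 : ℂ) * e1211 + (1 : ℂ) * e1212 + (1 : ℂ) * e1221 + ((3 : ℂ)/2) * e1311 +
      (-1 : ℂ) * e2111 + ((1 : ℂ)/2) * e2211
  · linear_combination ((-11 : ℂ)/2) * e1111 + (1 : ℂ) * e1112 + (1 : ℂ) * e1121 + (7 : ℂ) * e1211 +
      (-1 : ℂ) * e1212 + (-1 : ℂ) * e1221 + ((-3 : ℂ)/2) * e1311 + (1 : ℂ) * e2111 +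
      (-1 : ℂ) * e2211
  · linear_combination ((-5 : ℂ)/2) * e1111 + (2 : ℂ) * e1211 + ((-1 : ℂ)/2) * e1311 +
      (1 : ℂ) * e2111 + ((-1 : ℂ)/2) * e2211
  · linear_combination (1 : ℂ) * e1111 + (-1 : ℂ) * e1211 + (-1 : ℂ) * e2111 + (1 : ℂ) * e2211
  · linear_combination (-2 : ℂ) * e1111 + (2 : ℂ) * e1121 + (1 : ℂ) * e1211 + (-1 : ℂ) * e1221
  · linear_combination (-2 : ℂ) * e1111 + (2 : ℂ) * e1112 + (1 : ℂ) * e1211 + (-1 : ℂ) * e1212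
  · linear_combination ((1 : ℂ)/2) * e1111 + (-1 : ℂ) * e1211 + ((1 : ℂ)/2) * e1311
  · linear_combination (1 : ℂ) * e1111 + (-1 : ℂ) * e1121 + (-1 : ℂ) * e1211 + (1 : ℂ) * e1221
  · linear_combination (1 : ℂ) * e1111 + (-1 : ℂ) * e1112 + (-1 : ℂ) * e1211 + (1 : ℂ) * e1212

/-! ### §2 The normal form along the matching -/

/-- **Lemma A (normal form along the matching).**  Suppose that for every `φ` in the torus
`Q((φ₀,-φ₁,0,0), φ) = (Bψ)(B′φ)ᵀ + (C′φ)(Cψ)ᵀ` with `ψ = (φ₀,-φ₁,0,0)`, `(Bψ)_k = Σ_x ψ_x b_{xk}`,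
`(B′φ)_j = Σ_y φ_y b′_{yj}`, `(C′φ)_k = Σ_y φ_y c′_{yk}`, `(Cψ)_j = Σ_x ψ_x c_{xj}`.  Then the arrays are constrained as
listed (rows `0,1` of `b` and `c`, all of `b′` and `c′`), with `b₀₁ b′₂₃ = 1`, `c₀₁ c′₂₃ = 1`,
`b₀₁ b′₁₀ + c₀₁ c′₁₀ = 0`. -/
theorem matching_shape (b b' c c' : Fin 4 → Fin 4 → ℂ)
    (h : ∀ φ : Fin 4 → ℂ, (∀ i, φ i ≠ 0) →
      contract₀₁ permPattern₄ (lineVec (Sum.inr (0, 1)) φ) φ =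
        vecMulVec (fun k => ∑ x, lineVec (Sum.inr (0, 1)) φ x * b x k) (fun j => ∑ y, φ y * b' y j) +
        vecMulVec (fun k => ∑ y, φ y * c' y k) (fun j => ∑ x, lineVec (Sum.inr (0, 1)) φ x * c x j)) :
    -- `b`: rows 0, 1
    (b 0 0 = 0 ∧ b 1 1 = 0 ∧ b 1 0 = b 0 1 ∧ b 0 2 = 0 ∧ b 0 3 = 0 ∧ b 1 2 = 0 ∧ b 1 3 = 0) ∧
    -- `c`: rows 0, 1
    (c 0 0 = 0 ∧ c 1 1 = 0 ∧ c 1 0 = c 0 1 ∧ c 0 2 = 0 ∧ c 0 3 = 0 ∧ c 1 2 = 0 ∧ c 1 3 = 0) ∧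
    -- `b'`: everything
    (b' 0 0 = 0 ∧ b' 1 1 = 0 ∧ b' 0 1 = -b' 1 0 ∧ b' 2 0 = 0 ∧ b' 3 0 = 0 ∧ b' 2 1 = 0 ∧ b' 3 1 = 0 ∧
      b' 0 2 = 0 ∧ b' 1 2 = 0 ∧ b' 2 2 = 0 ∧ b' 0 3 = 0 ∧ b' 1 3 = 0 ∧ b' 3 3 = 0 ∧ b' 3 2 = b' 2 3) ∧
    -- `c'`: everything
    (c' 0 0 = 0 ∧ c' 1 1 = 0 ∧ c' 0 1 = -c' 1 0 ∧ c' 2 0 = 0 ∧ c' 3 0 = 0 ∧ c' 2 1 = 0 ∧ c' 3 1 = 0 ∧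
      c' 0 2 = 0 ∧ c' 1 2 = 0 ∧ c' 2 2 = 0 ∧ c' 0 3 = 0 ∧ c' 1 3 = 0 ∧ c' 3 3 = 0 ∧ c' 3 2 = c' 2 3) ∧
    -- scalar relations
    (b 0 1 * b' 2 3 = 1 ∧ c 0 1 * c' 2 3 = 1 ∧ b 0 1 * b' 1 0 + c 0 1 * c' 1 0 = 0) := by
  -- the four columns/rows as (opaque) affine functions of `φ`
  obtain ⟨x₁, hx₁⟩ : ∃ f : (Fin 4 → ℂ) → Fin 4 → ℂ, ∀ φ, f φ = fun k => ∑ x, lineVec (Sum.inr (0, 1)) φ x * b x k :=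
    ⟨_, fun _ => rfl⟩
  obtain ⟨y₁, hy₁⟩ : ∃ f : (Fin 4 → ℂ) → Fin 4 → ℂ, ∀ φ, f φ = fun j => ∑ y, φ y * b' y j := ⟨_, fun _ => rfl⟩
  obtain ⟨x₂, hx₂⟩ : ∃ f : (Fin 4 → ℂ) → Fin 4 → ℂ, ∀ φ, f φ = fun k => ∑ y, φ y * c' y k := ⟨_, fun _ => rfl⟩
  obtain ⟨y₂, hy₂⟩ : ∃ f : (Fin 4 → ℂ) → Fin 4 → ℂ, ∀ φ, f φ = fun j => ∑ x, lineVec (Sum.inr (0, 1)) φ x * c x j :=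
    ⟨_, fun _ => rfl⟩
  have h' : ∀ φ : Fin 4 → ℂ, (∀ i, φ i ≠ 0) → contract₀₁ permPattern₄ (lineVec (Sum.inr (0, 1)) φ) φ =
      vecMulVec (x₁ φ) (y₁ φ) + vecMulVec (x₂ φ) (y₂ φ) := fun φ hφ => by
    rw [hx₁, hy₁, hx₂, hy₂]; exact h φ hφ
  have hx₁' : ∀ φ k, x₁ φ k = (0 : Fin 4 → ℂ) k + ∑ x, (![b 0 k, -b 1 k, 0, 0] : Fin 4 → ℂ) x * φ x := by
    intro φ k; simp [hx₁, lineVec_matching, Fin.sum_univ_four]; ring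
  have hy₂' : ∀ φ k, y₂ φ k = (0 : Fin 4 → ℂ) k + ∑ x, (![c 0 k, -c 1 k, 0, 0] : Fin 4 → ℂ) x * φ x := by
    intro φ k; simp [hy₂, lineVec_matching, Fin.sum_univ_four]; ring
  have hx₂' : ∀ φ k, x₂ φ k = (0 : Fin 4 → ℂ) k + ∑ x, c' x k * φ x := by
    intro φ k; simp only [hx₂, Pi.zero_apply, zero_add]; exact Finset.sum_congr rfl fun y _ => mul_comm _ _
  have hy₁' : ∀ φ k, y₁ φ k = (0 : Fin 4 → ℂ) k + ∑ x, b' x k * φ x := by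
    intro φ k; simp only [hy₁, Pi.zero_apply, zero_add]; exact Finset.sum_congr rfl fun y _ => mul_comm _ _
  -- annihilators: columns and (by symmetry) rows
  have hann : ∀ φ : Fin 4 → ℂ, (∀ i, φ i ≠ 0) →
      ((φ 2 * x₁ φ 2 = φ 3 * x₁ φ 3 ∧ φ 2 * x₂ φ 2 = φ 3 * x₂ φ 3) ∧
       (φ 0 * x₁ φ 0 + φ 1 * x₁ φ 1 = 0 ∧ φ 0 * x₂ φ 0 + φ 1 * x₂ φ 1 = 0)) ∧
      ((φ 2 * y₁ φ 2 = φ 3 * y₁ φ 3 ∧ φ 2 * y₂ φ 2 = φ 3 * y₂ φ 3) ∧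
       (φ 0 * y₁ φ 0 + φ 1 * y₁ φ 1 = 0 ∧ φ 0 * y₂ φ 0 + φ 1 * y₂ φ 1 = 0)) := by
    intro φ hφ
    have hM := h' φ hφ
    have hE := contract_matching φ
    set M := contract₀₁ permPattern₄ (lineVec (Sum.inr (0, 1)) φ) φ with hMdef
    have hMT : M = vecMulVec (y₁ φ) (x₁ φ) + vecMulVec (y₂ φ) (x₂ φ) := by
      have hsym : M = Mᵀ := by rw [hE]; ext i j; fin_cases i <;> fin_cases j <;> simp
      rw [hsym, hM, transpose_add, transpose_vecMulVec, transpose_vecMulVec]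
    have hminor : M 0 2 * M 2 0 - M 0 0 * M 2 2 ≠ 0 := by
      have : M 0 2 * M 2 0 - M 0 0 * M 2 2 = (φ 1 * φ 3) ^ 2 := by rw [hE]; simp; ring
      rw [this]; exact pow_ne_zero 2 (mul_ne_zero (hφ 1) (hφ 3))
    have hminor' : M 2 0 * M 0 2 - M 2 2 * M 0 0 ≠ 0 := by
      have : M 2 0 * M 0 2 - M 2 2 * M 0 0 = (φ 1 * φ 3) ^ 2 := by rw [hE]; simp; ring
      rw [this]; exact pow_ne_zero 2 (mul_ne_zero (hφ 1) (hφ 3))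
    have hn1 : ∀ w, ∑ z, (![0, 0, φ 2, -φ 3] : Fin 4 → ℂ) z * M z w = 0 := fun w => by
      rw [hE]; (fin_cases w <;> simp [Fin.sum_univ_four]) <;> ring
    have hn2 : ∀ w, ∑ z, (![φ 0, φ 1, 0, 0] : Fin 4 → ℂ) z * M z w = 0 := fun w => by
      rw [hE]; (fin_cases w <;> simp [Fin.sum_univ_four]) <;> ring
    have c1 := two_rank_one_cols _ _ _ _ _ M hM hn1 hminor
    have c2 := two_rank_one_cols _ _ _ _ _ M hM hn2 hminor
    have r1 := two_rank_one_cols _ _ _ _ _ M hMT hn1 hminor'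
    have r2 := two_rank_one_cols _ _ _ _ _ M hMT hn2 hminor'
    simp [Fin.sum_univ_four] at c1 c2 r1 r2
    refine ⟨⟨⟨by linear_combination c1.1, by linear_combination c1.2⟩,
      ⟨by linear_combination c2.1, by linear_combination c2.2⟩⟩,
      ⟨⟨by linear_combination r1.1, by linear_combination r1.2⟩,
      ⟨by linear_combination r2.1, by linear_combination r2.2⟩⟩⟩
  -- coefficient extraction
  have qx₁ := quad_identity_23 0 (fun x k => (![b 0 k, -b 1 k, 0, 0] : Fin 4 → ℂ) x) (fun φ hφ => by
    have := (hann φ hφ).1.1.1; rwa [hx₁', hx₁'] at this)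
  have px₁ := quad_identity_01 0 (fun x k => (![b 0 k, -b 1 k, 0, 0] : Fin 4 → ℂ) x) (fun φ hφ => by
    have := (hann φ hφ).1.2.1; rwa [hx₁', hx₁'] at this)
  have qx₂ := quad_identity_23 0 c' (fun φ hφ => by have := (hann φ hφ).1.1.2; rwa [hx₂', hx₂'] at this)
  have px₂ := quad_identity_01 0 c' (fun φ hφ => by have := (hann φ hφ).1.2.2; rwa [hx₂', hx₂'] at this)
  have qy₁ := quad_identity_23 0 b' (fun φ hφ => by have := (hann φ hφ).2.1.1; rwa [hy₁', hy₁'] at this)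
  have py₁ := quad_identity_01 0 b' (fun φ hφ => by have := (hann φ hφ).2.2.1; rwa [hy₁', hy₁'] at this)
  have qy₂ := quad_identity_23 0 (fun x k => (![c 0 k, -c 1 k, 0, 0] : Fin 4 → ℂ) x) (fun φ hφ => by
    have := (hann φ hφ).2.1.2; rwa [hy₂', hy₂'] at this)
  have py₂ := quad_identity_01 0 (fun x k => (![c 0 k, -c 1 k, 0, 0] : Fin 4 → ℂ) x) (fun φ hφ => by
    have := (hann φ hφ).2.2.2; rwa [hy₂', hy₂'] at this)
  simp only [Matrix.cons_val_zero, Matrix.cons_val_one, Matrix.head_cons, Matrix.cons_val_two, Matrix.tail_cons,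
    Matrix.cons_val_three, neg_eq_zero] at qx₁ px₁ qy₂ py₂
  obtain ⟨b02, b12, b03, b13⟩ : b 0 2 = 0 ∧ b 1 2 = 0 ∧ b 0 3 = 0 ∧ b 1 3 = 0 := by
    obtain ⟨-, h1, h2, -, -, -, h4, h5, -⟩ := qx₁
    exact ⟨h1, h2, h4, h5⟩
  obtain ⟨b00, b0110, b11⟩ : b 0 0 = 0 ∧ -b 1 0 + b 0 1 = 0 ∧ b 1 1 = 0 := by
    obtain ⟨-, -, h1, h2, -, -, h3, -, -⟩ := px₁
    exact ⟨h1, h2, h3⟩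
  obtain ⟨c02, c12, c03, c13⟩ : c 0 2 = 0 ∧ c 1 2 = 0 ∧ c 0 3 = 0 ∧ c 1 3 = 0 := by
    obtain ⟨-, h1, h2, -, -, -, h4, h5, -⟩ := qy₂
    exact ⟨h1, h2, h4, h5⟩
  obtain ⟨c00, c0110, c11⟩ : c 0 0 = 0 ∧ -c 1 0 + c 0 1 = 0 ∧ c 1 1 = 0 := by
    obtain ⟨-, -, h1, h2, -, -, h3, -, -⟩ := py₂
    exact ⟨h1, h2, h3⟩
  obtain ⟨-, cp02, cp12, cp22, cp3223, -, cp03, cp13, cp33⟩ := qx₂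
  obtain ⟨-, -, cp00, cp1001, cp20, cp30, cp11, cp21, cp31⟩ := px₂
  obtain ⟨-, bp02, bp12, bp22, bp3223, -, bp03, bp13, bp33⟩ := qy₁
  obtain ⟨-, -, bp00, bp1001, bp20, bp30, bp11, bp21, bp31⟩ := py₁
  refine ⟨⟨b00, b11, by linear_combination -b0110, b02, b03, b12, b13⟩,
    ⟨c00, c11, by linear_combination -c0110, c02, c03, c12, c13⟩,
    ⟨bp00, bp11, by linear_combination bp1001, bp20, bp30, bp21, bp31, bp02, bp12, bp22, bp03, bp13, bp33, bp3223⟩,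
    ⟨cp00, cp11, by linear_combination cp1001, cp20, cp30, cp21, cp31, cp02, cp12, cp22, cp03, cp13, cp33, cp3223⟩,
    ?_⟩
  -- the scalar relations: evaluate at `φ = 𝟙`
  have hM1 := h (fun _ => 1) (fun _ => one_ne_zero)
  have l02 : contract₀₁ permPattern₄ (lineVec (Sum.inr (0, 1)) (fun _ => (1 : ℂ))) (fun _ => 1) 0 2 = -1 := by
    rw [contract_matching]; simp
  have l20 : contract₀₁ permPattern₄ (lineVec (Sum.inr (0, 1)) (fun _ => (1 : ℂ))) (fun _ => 1) 2 0 = -1 := by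
    rw [contract_matching]; simp
  have l00 : contract₀₁ permPattern₄ (lineVec (Sum.inr (0, 1)) (fun _ => (1 : ℂ))) (fun _ => 1) 0 0 = 0 := by
    rw [contract_matching]; simp
  rw [hM1] at l02 l20 l00
  simp only [Matrix.add_apply, vecMulVec_apply, lineVec_matching, Fin.sum_univ_four, Matrix.cons_val_zero,
    Matrix.cons_val_one, Matrix.head_cons, Matrix.cons_val_two, Matrix.tail_cons, Matrix.cons_val_three] at l02 l20 l00
  have hb10 : b 1 0 = b 0 1 := by linear_combination -b0110
  have hc10 : c 1 0 = c 0 1 := by linear_combination -c0110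
  refine ⟨?_, ?_, ?_⟩
  · linear_combination -l02 + (b' 0 2 + b' 1 2 + b' 2 2 + b' 3 2) * b00 + (c' 0 0 + c' 1 0 + c' 2 0 + c' 3 0) * c02 -
      (c' 0 0 + c' 1 0 + c' 2 0 + c' 3 0) * c12 - b 1 0 * bp02 - b 1 0 * bp12 - b 1 0 * bp22 - b' 3 2 * hb10 -
      b 0 1 * bp3223
  · linear_combination -l20 + (b' 0 0 + b' 1 0 + b' 2 0 + b' 3 0) * b02 - (b' 0 0 + b' 1 0 + b' 2 0 + b' 3 0) * b12 +
      (c' 0 2 + c' 1 2 + c' 2 2 + c' 3 2) * c00 - c 1 0 * cp02 - c 1 0 * cp12 - c 1 0 * cp22 - c' 3 2 * hc10 -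
      c 0 1 * cp3223
  · linear_combination -l00 + (b' 0 0 + b' 1 0 + b' 2 0 + b' 3 0) * b00 + (c' 0 0 + c' 1 0 + c' 2 0 + c' 3 0) * c00 -
      b 1 0 * bp00 - b 1 0 * bp20 - b 1 0 * bp30 - c 1 0 * cp00 - c 1 0 * cp20 - c 1 0 * cp30 - b' 1 0 * hb10 -
      c' 1 0 * hc10

end LaplaceFourLine

end Summit.ValiantsHypothesis.ValiantsHypothesis.Theorems.RigidityForcesSymmetryRankRigidMinimalRepr
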